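import Summits.BirchSwinnertonDyer.Rank1Residual.Additive.StrictSignedSelmerInftyLocal
import Summits.BirchSwinnertonDyer.Rank1Residual.Additive.LocalTowerKernelDescent
import Summits.BirchSwinnertonDyer.Rank1Residual.Additive.LocalKummerConditionLift
import Literature.NumberTheory.EllipticCurves.SelmerCorankControlRatLevelZeroProofs
import HarnessLib

/-!
# Brick B2 of the GLOBAL count (C): `A₀ = h₀⁻¹(Sel^{ε,str}(E/K_∞))` IS the group of classes over `K`
# satisfying the LEVEL-`∞` local conditions, and `Sel^{ε,str}(E/K_0)` is its subgroup cut out by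
# the LEVEL-`0` conditions at the finitely many places of `S` and at the model `E` — i.e.
# `A₀ / Sel₀ ≅ im(λ₀) ∩ ker(c)` in set-theoretic form (cell `b2b-bsdres`, CLASS-CLOSURE lane, class
# O10 — x1b GEN 35, class lead; file 47 of the series: brick B2, part 4 — assembly)

HONEST FRAMING (cell `b2b-bsdres`, run/shared/lean/b2b/bsd-rank1-residual/, verbatim in every
file): the goal of the cell is to DELETE the COMBINATION-SHAPED residual classes of the
Birch–Swinnerton-Dyer formula for ALL analytic-rank `≤ 1` elliptic curves over `ℚ` — "full BSD
formula for every rank `≤ 1` curve in class `C`" assembled STRICTLY from published theorems — so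
that the rank-`≤ 1` remainder becomes exactly the CONSTRUCTION-SHAPED classes, which are TYPED
(missing-input `Prop`s), NOT attempted. This is not "finishing BSD". CLASS-CLOSURE lane: prove
what is provable now; shrink each hard class to its core with data; no claim beyond stated classes;
research routes on CONSTRUCTION-SHAPED X12 / O10; census / instrument output = EVIDENCE / conjecture
items, NEVER a Literature fact; `RESIDUAL-MAP.md` marks change only by signed lines. THIS FILE:
TOOL THEOREMS ONLY over p17's / the tree's objects (`strictSignedSelmerLayer`, `strictSignedSelmerInfty`,
`localKummerOverOfEmb`, `selmerInfty`, `localTowerKer`) — no definition, no named Literature fact,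
no Summits-side fact `def … : Prop`, no `sorry`, axioms standard; nothing is booked; no label /
mark / count / sub-cell moves; (C1_η), (C2_η-GZ), (C3_η) stay typed as filed; O10 stays OPEN /
CONSTRUCTION-SHAPED; nothing about `BSD(W, p)` of any pair is claimed.

## What (x1b GEN 34 `HSUM-UNCONDITIONAL-x1b.md` §3b, brick B2: `A₀ ⧸ S₀ ≅ ker(c) ∩ im(λ₀)`)

Notation: `K` a number field, `W/K` elliptic, `κ` a `ℤ_p`-extension with layers `K_n`
(`κ⁻¹(pⁿℤ_p)`, `K_0 = K`), `E` a `K`-field modelling the completion at the place above `p`,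
`ε = ±1`; `Sel^{ε,str}(E/K_n) ≤ H¹(K_n, E[p^∞])`, `Sel^{ε,str}(E/K_∞) = ⋃ₙ hₙ(Sel^{ε,str}(E/K_n))`
(p17, `StrictSignedSelmer.lean`), `h₀ : H¹(K, E[p^∞]) → H¹(K_∞, E[p^∞])`,
`A₀ = h₀⁻¹(Sel^{ε,str}(E/K_∞))` (the group of B1, file 42), and `A₀'` = the classes `y` over `K`
with `h₀ y ∈ Sel_{p^∞}(E/K_∞)` (classical local conditions over `K_∞`) and
`h₀ y ∈ Kummer_∞(⋃ₙ E^{ε,str}(K_n·E))` at the chosen embedding (all its conjugates agree on `h₀ y`).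

* (file 46, `LocalKummerConditionLift`) `mem_localKummerOverOfEmb_of_resOfLe` — local injectivity up
  the tower for Kummer conditions when `E(K_∞·E)[p^∞] = 0`.
* §1 **`A₀' ⊆ A₀`** (`exists_resOfLe_mem_strictSignedSelmerLayer_of_local`): for `y ∈ A₀'` there is
  `n` with `res_{K_n/K} y ∈ Sel^{ε,str}(E/K_n)` — the classical conditions at the finitely many
  `v ∈ S` descend to a finite layer by the continuity of `H¹` (file 44,
  `exists_forall_forall_resOfLe_localSubgroup_eq_zero`), hold automatically at good `v ∤ p` outside
  `S` (`localTowerKer_zero_eq_bot_of_hasGoodReductionAt`, Greenberg Lemma 3.3) and at the infinite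
  places (split completely); the strict signed condition descends by file 46 once `n` is past the layer
  carrying the point `pᵏQ ∈ E^{ε,str}(K_m·E)` (file 45, `mem_iSup_strictSignedLocalPointsOfEmb_iff`,
  `strictSignedLocalPointsOfEmb_mono`); hence `h₀ y = hₙ(res y) ∈ Sel^{ε,str}(E/K_∞)`. With file
  45's `A₀ ⊆ A₀'`: **`comap_layerToInfty_zero_strictSignedSelmerInfty_eq`** (`A₀ = A₀'`).
* §2 **`S₀ = A₀ ∩ ker(level-0 localisation at S and E)`**
  (`mem_strictSignedSelmerLayer_zero_iff_of_layerToInfty_mem`): for `y` with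
  `h₀ y ∈ Sel_{p^∞}(E/K_∞)`, `y ∈ Sel^{ε,str}(E/K_0)` iff `loc_v y = 0` in `H¹(K_v, E)` for the
  finitely many `v ∈ S` and `y ∈ Kummer_0(E^{ε,str}(K_0·E))` (the tree's
  `mem_selmerLayer_of_forall_localResOver_conjH1_eq_zero` with one representative per place).
  Together: `A₀ ⧸ Sel^{ε,str}(E/K_0)` embeds into the product of the level-`0` local receptacles at
  `S ∪ {E}` with image the localisations of the classes satisfying the level-`∞` conditions —
  `coker(a) ≅ ker(c) ∩ im(λ₀)` of `C3ETA-TRANSVERSALITY-x1b.md` §4, whose COUNT needs B3–B6.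

Hypotheses: `W` elliptic; `S ⊇ {v ∣ p} ∪ {bad v}` finite; for §1 `E(K_∞·E)[p^∞] = 0` (no
`Gal(K̄_E/K_∞·E)`-fixed `p`-power torsion in `E(K̄_E)`). Any `K`, `κ`, `E`, `ε`.

References: [GreenbergLNM1716] R. Greenberg, LNM 1716 (1999), §3 pp. 85–90 (the maps `s_n, h_n, g_n`,
Lemmas 3.1–3.3, `ker g_n`); [Kobayashi2003] S. Kobayashi, Invent. Math. 152 (2003), Def. 2.1 (p. 5),
Lemma 9.1 (p. 25), Thm. 9.3 (p. 26); [SerreGaloisCohomology1997] I.§2.2 Prop. 8, I.§5.1.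
-/

noncomputable section

open scoped Classical

open NumberField IsDedekindDomain

universe u

namespace Summit.BirchSwinnertonDyer.Rank1Residual.Additive

open Literature.NumberTheory.EllipticCurves Literature.NumberTheory.GaloisRepresentations
  Literature.NumberTheory.EllipticCurves.Kobayashi2003 ZpExtension

/-! ## §1 `A₀' ⊆ A₀`: the level-`∞` local conditions descend to a finite layer -/

section ConjZero

variable {K : Type u} [Field K] (W : WeierstrassCurve K) {p : ℕ} [Fact p.Prime] (κ : ZpExtension K p)

/-- `Γ_K = Gal(K̄/K_0)` acts trivially on `H¹(K_0, E[p^∞])` (`κ⁻¹(p⁰ℤ_p) = ⊤`, inner automorphisms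
act trivially: `conjH1_of_mem`). [folklore] -/
theorem conjH1_layerSubgroup_zero_apply (σ : Field.absoluteGaloisGroup K)
    (y : W.subgroupH1 p (κ.layerSubgroup 0)) : W.conjH1 p (κ.layerSubgroup 0) σ y = y := by
  have hσ : σ ∈ κ.layerSubgroup 0 := by rw [layerSubgroup_zero]; exact Subgroup.mem_top σ
  rw [W.conjH1_of_mem_holds p (κ.layerSubgroup 0) hσ, AddMonoidHom.id_apply]

/-- Conjugation of a class restricted from `K_0` to `K_n` is trivial: `conj_σ (res y) = res (conj_σ y)
= res y` (`resOfLe_comp_conjH1`, `conjH1_layerSubgroup_zero_apply`). [folklore] -/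
theorem conjH1_resOfLe_layerSubgroup_zero (n : ℕ) (σ : Field.absoluteGaloisGroup K)
    (y : W.subgroupH1 p (κ.layerSubgroup 0)) :
    W.conjH1 p (κ.layerSubgroup n) σ (W.resOfLe p (κ.layerSubgroup_antitone (Nat.zero_le n)) y) =
      W.resOfLe p (κ.layerSubgroup_antitone (Nat.zero_le n)) y := by
  have h := congrArg (fun f ↦ f y)
    (resOfLe_comp_conjH1_holds (M := W.geomPrimaryTorsion p) (κ.layerSubgroup_antitone (Nat.zero_le n)) σ)
  simp only [AddMonoidHom.coe_comp, Function.comp_apply] at h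
  rw [← h, conjH1_layerSubgroup_zero_apply]

end ConjZero

section Preimage

variable {K : Type u} [Field K] [NumberField K] (W : WeierstrassCurve K) {p : ℕ} [Fact p.Prime]
  (κ : ZpExtension K p) (E : Type u) [Field E] [Algebra K E] (ε : ℤˣ)

/-- For `y` over `K` with `h₀ y ∈ Sel_{p^∞}(E/K_∞)`, the localisation of `y` at a finite place `v`
lies in the level-`0` local tower kernel `𝒦_{v,0}` (the tree's
`localResOver_conjH1_mem_localTowerKer_of_mem` at `σ = 1`). [cite: GreenbergLNM1716, §3 pp. 85–86] -/
theorem localResOver_mem_localTowerKer_zero {y : W.subgroupH1 p (κ.layerSubgroup 0)}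
    (hsel : W.layerToInfty κ 0 y ∈ W.selmerInfty κ) (v : HeightOneSpectrum (𝓞 K)) :
    W.localResOver p (κ.layerSubgroup 0) (v.adicCompletion K) y ∈
      W.localTowerKer κ (v.adicCompletion K) 0 := by
  have h := W.localResOver_conjH1_mem_localTowerKer_of_mem κ (n := 0) (y := y) hsel v 1
  rwa [W.conjH1_one_holds p (κ.layerSubgroup 0), AddMonoidHom.id_apply] at h

/-- **The classical level-`∞` condition read at level `0`.** For `y ∈ H¹(K, E[p^∞])`:
`h₀ y ∈ Sel_{p^∞}(E/K_∞)` iff at every finite place `v` and every infinite place `w` the level-`0`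
localisation of `y` lies in the local tower kernel `𝒦_{·,0} = ker (H¹(K_v, E) → H¹(K_{∞,η}, E))`
(`conj_σ (h₀ y) = h₀ y`; localisation commutes with restriction, `localResOverOfEmb_resOfLe`). This is
`y ∈ λ₀⁻¹(ker c)` for the classical components of `c`. [cite: GreenbergLNM1716, §3 pp. 85–86] -/
theorem layerToInfty_zero_mem_selmerInfty_iff (y : W.subgroupH1 p (κ.layerSubgroup 0)) :
    W.layerToInfty κ 0 y ∈ W.selmerInfty κ ↔
      (∀ v : HeightOneSpectrum (𝓞 K),
          W.localResOver p (κ.layerSubgroup 0) (v.adicCompletion K) y ∈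
            W.localTowerKer κ (v.adicCompletion K) 0) ∧
        ∀ w : InfinitePlace K,
          W.localResOver p (κ.layerSubgroup 0) w.Completion y ∈ W.localTowerKer κ w.Completion 0 := by
  have hconj : ∀ σ : Field.absoluteGaloisGroup K,
      W.conjH1 p κ.kerSubgroup σ (W.layerToInfty κ 0 y) = W.layerToInfty κ 0 y := fun σ ↦ by
    rw [← W.layerToInfty_conjH1 κ σ y, conjH1_layerSubgroup_zero_apply]
  have hloc : ∀ (F : Type u) [Field F] [Algebra K F],
      W.layerToInfty κ 0 y ∈ W.localKerOver p κ.kerSubgroup F ↔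
        W.localResOver p (κ.layerSubgroup 0) F y ∈ W.localTowerKer κ F 0 := by
    intro F _ _
    rw [WeierstrassCurve.mem_localKerOver_iff, WeierstrassCurve.mem_localTowerKer_iff]
    change W.localResOverOfEmb p κ.kerSubgroup (closureEmb (K := K) F)
        (W.resOfLe p (κ.kerSubgroup_le_layerSubgroup 0) y) = 0 ↔ _
    rw [W.localResOverOfEmb_resOfLe p (closureEmb (K := K) F) (κ.kerSubgroup_le_layerSubgroup 0) y]
    rfl
  change W.layerToInfty κ 0 y ∈ W.selmerGroupOver p κ.kerSubgroup ↔ _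
  rw [WeierstrassCurve.mem_selmerGroupOver_iff]
  simp only [hconj, hloc, forall_const]

/-- Same at an infinite place `w`: there the local tower kernel vanishes (`w` splits completely in
`K_∞/K`), so the localisation of `y` at `w` is `0`. [cite: GreenbergLNM1716, §3 p. 86] -/
theorem localResOver_infinitePlace_eq_zero {y : W.subgroupH1 p (κ.layerSubgroup 0)}
    (hsel : W.layerToInfty κ 0 y ∈ W.selmerInfty κ) (w : InfinitePlace K) :
    W.localResOver p (κ.layerSubgroup 0) w.Completion y = 0 := by
  have h := W.localResOver_conjH1_mem_localTowerKer_of_mem_infinitePlace κ (n := 0) (y := y) hsel w 1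
  rw [W.conjH1_one_holds p (κ.layerSubgroup 0), AddMonoidHom.id_apply,
    W.localTowerKer_eq_bot_of_forall_mem κ w.Completion 0 (κ.resGal_infinitePlace_mem_kerSubgroup w),
    AddSubgroup.mem_bot] at h
  exact h

/-- At a good place `v ∤ p` the localisation of such a `y` is `0` (`𝒦_{v,0} = 0`, Greenberg's Lemma
3.3 / Lang–Tate, the tree's `localTowerKer_zero_eq_bot_of_hasGoodReductionAt`).
[cite: GreenbergLNM1716, §3 Lemma 3.3 (pp. 86–87)] -/
theorem localResOver_eq_zero_of_hasGoodReductionAt [W.IsElliptic] {y : W.subgroupH1 p (κ.layerSubgroup 0)}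
    (hsel : W.layerToInfty κ 0 y ∈ W.selmerInfty κ) (v : HeightOneSpectrum (𝓞 K))
    (hpv : (p : 𝓞 K) ∉ v.asIdeal) (hgood : W.HasGoodReductionAt v) :
    W.localResOver p (κ.layerSubgroup 0) (v.adicCompletion K) y = 0 := by
  have h := localResOver_mem_localTowerKer_zero W κ hsel v
  rw [W.localTowerKer_zero_eq_bot_of_hasGoodReductionAt κ v hpv hgood, AddSubgroup.mem_bot] at h
  exact h

/-- **`A₀' ⊆ A₀` (brick B2, the descent).** Let `W/K` be elliptic, `S` a finite set of finite places
containing all `v ∣ p` and all bad places, `E` a `K`-field with `E(K_∞·E)[p^∞] = 0` (no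
`Gal(K̄_E/K_∞·E)`-fixed `p`-power torsion in `E(K̄_E)`), `ε = ±1`. If `y ∈ H¹(K, E[p^∞])` satisfies the
LEVEL-`∞` local conditions — `h₀ y ∈ Sel_{p^∞}(E/K_∞)` and `h₀ y ∈ Kummer_∞(⋃ₘ E^{ε,str}(K_m·E))` —
then for some `n` its restriction to `K_n` lies in `Sel^{ε,str}(E/K_n)`: the classical conditions
at `v ∈ S` descend by the continuity of `H¹` (file 44), hold at good `v ∉ S` and at infinity at
every layer, and the strict signed Kummer condition descends by §1 once `n` is past the layer of
the point `pᵏQ ∈ E^{ε,str}(K_{m₀}·E)` (file 45). [cite: GreenbergLNM1716, §3 pp. 85–90]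
[cite: Kobayashi2003, Def. 2.1 (p. 5), Lemma 9.1 (p. 25)] -/
theorem exists_resOfLe_mem_strictSignedSelmerLayer_of_local [W.IsElliptic]
    (S : Finset (HeightOneSpectrum (𝓞 K)))
    (hS : ∀ v ∉ S, (p : 𝓞 K) ∉ v.asIdeal ∧ W.HasGoodReductionAt v)
    (htors : ∀ P : localPoints W E, P ∈ localFixedPointsOfEmb (closureEmb (K := K) E) W κ.kerSubgroup →
      (∃ j : ℕ, p ^ j • P = 0) → P = 0)
    {y : W.subgroupH1 p (κ.layerSubgroup 0)} (hsel : W.layerToInfty κ 0 y ∈ W.selmerInfty κ)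
    (hkum : W.layerToInfty κ 0 y ∈ localKummerOverOfEmb W p κ.kerSubgroup (closureEmb (K := K) E)
      (⨆ m, strictSignedLocalPoints κ E W ε m)) :
    ∃ n : ℕ, W.resOfLe p (κ.layerSubgroup_antitone (Nat.zero_le n)) y ∈
      strictSignedSelmerLayer W κ E ε n := by
  -- (a) the Kummer datum lives at a finite layer `m₀`
  obtain ⟨φ, Q, k, hφc, hQA, hφ⟩ := hkum
  obtain ⟨m₀, hm₀⟩ := (mem_iSup_strictSignedLocalPointsOfEmb_iff κ (closureEmb (K := K) E) W ε _).mp hQA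
  -- (b) the classical conditions at `S` descend to a finite layer `n₁`
  obtain ⟨n₁, hn₁⟩ := exists_forall_forall_resOfLe_localSubgroup_eq_zero W κ
    (fun v : ↥S ↦ v.1.adicCompletion K)
    (fun v ↦ W.localResOver p (κ.layerSubgroup 0) (v.1.adicCompletion K) y)
    (fun v ↦ localResOver_mem_localTowerKer_zero W κ hsel v.1)
  refine ⟨max m₀ n₁, ?_⟩
  set n := max m₀ n₁ with hn
  have hle : κ.layerSubgroup n ≤ κ.layerSubgroup 0 := κ.layerSubgroup_antitone (Nat.zero_le n)
  rw [mem_strictSignedSelmerLayer_iff]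
  constructor
  · -- the classical conditions at layer `n`
    change W.resOfLe p hle y ∈ W.selmerGroupOver p (κ.layerSubgroup n)
    rw [WeierstrassCurve.mem_selmerGroupOver_iff]
    refine ⟨fun v σ ↦ ?_, fun w σ ↦ ?_⟩
    · rw [conjH1_resOfLe_layerSubgroup_zero, WeierstrassCurve.mem_localKerOver_iff]
      change W.localResOverOfEmb p (κ.layerSubgroup n) (closureEmb (K := K) (v.adicCompletion K))
        (W.resOfLe p hle y) = 0
      rw [W.localResOverOfEmb_resOfLe p (closureEmb (K := K) (v.adicCompletion K)) hle y]
      by_cases hv : v ∈ S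
      · exact hn₁ ⟨v, hv⟩ n (le_max_right _ _)
      · change Literature.NumberTheory.EllipticCurves.resOfLe (localPoints W (v.adicCompletion K)) _
          (W.localResOver p (κ.layerSubgroup 0) (v.adicCompletion K) y) = 0
        rw [localResOver_eq_zero_of_hasGoodReductionAt W κ hsel v (hS v hv).1 (hS v hv).2, map_zero]
    · rw [conjH1_resOfLe_layerSubgroup_zero, WeierstrassCurve.mem_localKerOver_iff]
      change W.localResOverOfEmb p (κ.layerSubgroup n) (closureEmb (K := K) w.Completion)
        (W.resOfLe p hle y) = 0
      rw [W.localResOverOfEmb_resOfLe p (closureEmb (K := K) w.Completion) hle y]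
      change Literature.NumberTheory.EllipticCurves.resOfLe (localPoints W w.Completion) _
        (W.localResOver p (κ.layerSubgroup 0) w.Completion y) = 0
      rw [localResOver_infinitePlace_eq_zero W κ hsel w, map_zero]
  · -- the strict signed Kummer condition at layer `n`, by local injectivity (§1)
    intro σ
    rw [conjH1_resOfLe_layerSubgroup_zero]
    refine mem_localKummerOverOfEmb_of_resOfLe W p (closureEmb (K := K) E) (κ.kerSubgroup_le_layerSubgroup n)
      (strictSignedLocalPointsOfEmb_le_localLayerPoints κ (closureEmb (K := K) E) W ε n) htors ?_
    have hcomp := congrArg (fun f ↦ f y)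
      (W.resOfLe_comp_holds p (κ.kerSubgroup_le_layerSubgroup n) hle)
    simp only [AddMonoidHom.coe_comp, Function.comp_apply] at hcomp
    rw [hcomp]
    exact ⟨φ, Q, k, hφc, strictSignedLocalPointsOfEmb_mono κ (closureEmb (K := K) E) W ε (le_max_left _ _) hm₀, hφ⟩

/-- **`A₀ = A₀'` (brick B2 of the GLOBAL count (C), set-theoretic form).** Under the hypotheses of
`exists_resOfLe_mem_strictSignedSelmerLayer_of_local`: a class `y ∈ H¹(K, E[p^∞])` restricts into
`Sel^{ε,str}(E/K_∞) = ⋃ₙ hₙ(Sel^{ε,str}(E/K_n))` iff `h₀ y` satisfies the LEVEL-`∞` local conditions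
(`Sel_{p^∞}(E/K_∞)` and the strict signed Kummer condition cut out by `⋃ₙ E^{ε,str}(K_n·E)` at every
conjugate of the chosen embedding) — `⊆` is file 45 (`comap_layerToInfty_strictSignedSelmerInfty_le`),
`⊇` is the descent (`h₀ y = hₙ (res y)`). So `A₀ = h₀⁻¹(Sel^{ε,str}(E/K_∞))` of B1 (file 42) is the
Selmer group over `K` of the pulled-back level-`∞` conditions, `λ₀⁻¹(ker c)` in the notation of
`C3ETA-TRANSVERSALITY-x1b.md` §4. [cite: GreenbergLNM1716, §3 pp. 85–90] [cite: Kobayashi2003, Def. 2.1 (p. 5)] -/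
theorem comap_layerToInfty_zero_strictSignedSelmerInfty_eq [W.IsElliptic]
    (S : Finset (HeightOneSpectrum (𝓞 K)))
    (hS : ∀ v ∉ S, (p : 𝓞 K) ∉ v.asIdeal ∧ W.HasGoodReductionAt v)
    (htors : ∀ P : localPoints W E, P ∈ localFixedPointsOfEmb (closureEmb (K := K) E) W κ.kerSubgroup →
      (∃ j : ℕ, p ^ j • P = 0) → P = 0) :
    (strictSignedSelmerInfty W κ E ε).comap (W.layerToInfty κ 0) =
      (W.selmerInfty κ ⊓
        ⨅ σ : Field.absoluteGaloisGroup K,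
          (localKummerOverOfEmb W p κ.kerSubgroup (closureEmb (K := K) E)
              (⨆ m, strictSignedLocalPoints κ E W ε m)).comap (W.conjH1 p κ.kerSubgroup σ)).comap
        (W.layerToInfty κ 0) := by
  refine le_antisymm (comap_layerToInfty_strictSignedSelmerInfty_le W κ E ε 0) fun y hy ↦ ?_
  simp only [AddSubgroup.mem_comap, AddSubgroup.mem_inf, AddSubgroup.mem_iInf] at hy
  obtain ⟨hsel, hkum⟩ := hy
  have h1 := hkum 1
  rw [W.conjH1_one_holds p κ.kerSubgroup, AddMonoidHom.id_apply] at h1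
  obtain ⟨n, hn⟩ := exists_resOfLe_mem_strictSignedSelmerLayer_of_local W κ E ε S hS htors hsel h1
  rw [AddSubgroup.mem_comap]
  have hcomp := congrArg (fun f ↦ f y)
    (W.resOfLe_comp_holds p (κ.kerSubgroup_le_layerSubgroup n) (κ.layerSubgroup_antitone (Nat.zero_le n)))
  simp only [AddMonoidHom.coe_comp, Function.comp_apply] at hcomp
  change W.resOfLe p (κ.kerSubgroup_le_layerSubgroup 0) y ∈ strictSignedSelmerInfty W κ E ε
  rw [← hcomp]
  exact map_layerToInfty_strictSignedSelmerLayer_le W κ E ε n ⟨_, hn, rfl⟩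

end Preimage

/-! ## §2 `Sel^{ε,str}(E/K_0)` inside `A₀`: the level-`0` conditions at `S` and at `E` -/

section KernelZero

variable {K : Type u} [Field K] [NumberField K] (W : WeierstrassCurve K) {p : ℕ} [Fact p.Prime]
  (κ : ZpExtension K p) (E : Type u) [Field E] [Algebra K E] (ε : ℤˣ)

/-- **`S₀ = A₀ ∩ ker(level-0 localisation at S ∪ {E})`.** Let `W/K` be elliptic and `S` a finite
set of finite places containing all `v ∣ p` and all bad places. For a class `y ∈ H¹(K, E[p^∞])`
with `h₀ y ∈ Sel_{p^∞}(E/K_∞)` (in particular for `y ∈ A₀`): `y ∈ Sel^{ε,str}(E/K_0)` iff `y` dies in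
`H¹(K_v, E)` for the finitely many `v ∈ S` AND `y` satisfies the level-`0` strict signed Kummer
condition at the chosen embedding (for `ε = −1`: the `p`-STRICT condition, p17 FILE 3). The
conditions outside `S` and at infinity are automatic (`𝒦_{v,0} = 0` at good `v ∤ p`, Greenberg
Lemma 3.3; archimedean places split), via the tree's
`mem_selmerLayer_of_forall_localResOver_conjH1_eq_zero` with one representative per place
(`Γ_K = Gal(K̄/K_0)`). Hence `A₀ ⧸ Sel^{ε,str}(E/K_0)` embeds into the product of the level-`0`
local receptacles at `S ∪ {E}` — `coker(a) ≅ ker(c) ∩ im(λ₀)`.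
[cite: GreenbergLNM1716, §3 Lemma 3.3 (pp. 86–87) and p. 90] [cite: Kobayashi2003, Def. 2.1 (p. 5)] -/
theorem mem_strictSignedSelmerLayer_zero_iff_of_layerToInfty_mem [W.IsElliptic]
    (S : Finset (HeightOneSpectrum (𝓞 K)))
    (hS : ∀ v ∉ S, (p : 𝓞 K) ∉ v.asIdeal ∧ W.HasGoodReductionAt v)
    {y : W.subgroupH1 p (κ.layerSubgroup 0)} (hsel : W.layerToInfty κ 0 y ∈ W.selmerInfty κ) :
    y ∈ strictSignedSelmerLayer W κ E ε 0 ↔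
      (∀ v ∈ S, W.localResOver p (κ.layerSubgroup 0) (v.adicCompletion K) y = 0) ∧
        y ∈ localKummerOverOfEmb W p (κ.layerSubgroup 0) (closureEmb (K := K) E)
          (strictSignedLocalPoints κ E W ε 0) := by
  rw [mem_strictSignedSelmerLayer_iff]
  constructor
  · rintro ⟨hsel0, hk⟩
    refine ⟨fun v _ ↦ ?_, ?_⟩
    · have h := ((W.mem_selmerGroupOver_iff p (κ.layerSubgroup 0) y).mp hsel0).1 v 1
      rwa [W.conjH1_one_holds p (κ.layerSubgroup 0), AddMonoidHom.id_apply,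
        WeierstrassCurve.mem_localKerOver_iff] at h
    · have h := hk 1
      rwa [W.conjH1_one_holds p (κ.layerSubgroup 0), AddMonoidHom.id_apply] at h
  · rintro ⟨hloc, hk⟩
    refine ⟨?_, fun σ ↦ ?_⟩
    · refine W.mem_selmerLayer_of_forall_localResOver_conjH1_eq_zero κ S
        (fun v hv ↦ W.localTowerKerPrimary_zero_eq_bot_of_hasGoodReductionAt κ v (hS v hv).1 (hS v hv).2)
        (fun _ ↦ {1}) (fun v _ σ ↦ ⟨1, Finset.mem_singleton_self 1, 1, σ,
          by rw [layerSubgroup_zero]; exact Subgroup.mem_top σ, by rw [map_one, one_mul, one_mul]⟩)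
        hsel fun v hv ρ hρ ↦ ?_
      rw [Finset.mem_singleton] at hρ
      rw [hρ, W.conjH1_one_holds p (κ.layerSubgroup 0), AddMonoidHom.id_apply]
      exact hloc v hv
    · rw [conjH1_layerSubgroup_zero_apply]
      exact hk

/-- **B2 assembled on `A₀`.** For `y ∈ A₀ = h₀⁻¹(Sel^{ε,str}(E/K_∞))`: `y ∈ Sel^{ε,str}(E/K_0)` iff `y`
dies in `H¹(K_v, E)` for `v ∈ S` and satisfies the level-`0` strict signed Kummer condition at `E`
(`Sel^{ε,str}(E/K_∞) ≤ Sel_{p^∞}(E/K_∞)` supplies the hypothesis of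
`mem_strictSignedSelmerLayer_zero_iff_of_layerToInfty_mem`). With
`comap_layerToInfty_zero_strictSignedSelmerInfty_eq` this is `A₀ ⧸ S₀ ≅ im(λ₀) ∩ ker(c)` of the
(C3_η) derivation in set-theoretic form: the localisation at `S ∪ {E}` is injective on `A₀ ⧸ S₀` and
`A₀` is exactly the group of classes whose localisations satisfy the level-`∞` conditions.
[cite: GreenbergLNM1716, §3 pp. 85–90] [cite: Kobayashi2003, Def. 2.1 (p. 5), Thm. 9.3 (p. 26)] -/
theorem mem_strictSignedSelmerLayer_zero_iff_of_mem_comap [W.IsElliptic]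
    (S : Finset (HeightOneSpectrum (𝓞 K)))
    (hS : ∀ v ∉ S, (p : 𝓞 K) ∉ v.asIdeal ∧ W.HasGoodReductionAt v)
    {y : W.subgroupH1 p (κ.layerSubgroup 0)}
    (hy : y ∈ (strictSignedSelmerInfty W κ E ε).comap (W.layerToInfty κ 0)) :
    y ∈ strictSignedSelmerLayer W κ E ε 0 ↔
      (∀ v ∈ S, W.localResOver p (κ.layerSubgroup 0) (v.adicCompletion K) y = 0) ∧
        y ∈ localKummerOverOfEmb W p (κ.layerSubgroup 0) (closureEmb (K := K) E)
          (strictSignedLocalPoints κ E W ε 0) :=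
  mem_strictSignedSelmerLayer_zero_iff_of_layerToInfty_mem W κ E ε S hS
    (strictSignedSelmerInfty_le_selmerInfty W κ E ε (AddSubgroup.mem_comap.mp hy))

end KernelZero

end Summit.BirchSwinnertonDyer.Rank1Residual.Additive

end
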